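import Summits.MatrixMultiplication.MatrixMultiplication.Theorems.SoloBlindKraftSets

/-!
# The cone lift: Conjecture E and the Kraft inequality (K₃) are equivalent (all ranks)

Sub-programme (K₃).  For `h : ι → G` zero-sum free on `S` (exponent-`3` group `G`) and a target `τ`, the Kraft
mass is `K(τ; S) = ∑_{T ⊆ S, ∑_T h = τ} 2^{-|T|}` (`soloBlindMass`); (K₃) says `K ≤ 1`, CONJECTURE E says
`K(τ; S) ≤ 1/2` whenever `τ` is H-good on `S` (`∑_T h ≠ τ + τ` for all `T ⊆ S`).

THE CONE LIFT.  Put `h` into the first factor of `G × ZMod 3` and adjoin a fresh apex `v` (the index `none`)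
with value `(0, 1)` (`soloBlindCone`).  Then the cone is zero-sum free on `insertNone S` (`soloBlind_cone_zsf`),
the target `(σ, 1)` is H-good for EVERY `σ` — a sub-sum has second coordinate `0` or `1`, never `1 + 1`
(`soloBlind_cone_hgood`) — and the representations of `(σ, 1)` are exactly the sets `T ∪ {v}` with `T`
representing `σ` (`soloBlind_cone_repAll`), so `K((σ,1); cone) = K(σ; S) / 2` (`soloBlind_cone_mass`).
Consequently CONJECTURE E IMPLIES (K₃) AT EVERY TARGET (`soloBlind_kraft_of_conjE`), not only on the value
stratum (`soloBlind_kraft_value_of_conjE`); the converse (`soloBlind_conjE_of_kraft`) is the virtual point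
`v ↦ τ`: `K(τ; S ∪ {v}) = 1/2 + K(τ; S)` (`soloBlind_adjoin_mass`).  So E and (K₃) are ONE conjecture, and every
(K₃)-tight configuration of rank `r` (e.g. the two-pair type `(2,2,3,3,3,4,4)` on a maximum zero-sum-free subset
of `𝔽₃⁴`) lifts to an E-tight CONE of rank `r + 1` (the nine-point design `(3,3,4,4,4,5,5)` of the `N₃ = 2` case).
-/

namespace Summit.MatrixMultiplication.MatrixMultiplication.Theorems

open Finset

universe u v

variable {ι : Type v} [DecidableEq ι]
variable {G : Type u} [AddCommGroup G] [DecidableEq G]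

omit [DecidableEq G] in
/-- An apex indicator sums to the indicator of `none ∈ T`. -/
theorem soloBlind_sum_ite_none (T : Finset (Option ι)) (c : G) :
    ∑ o ∈ T, (if o = none then c else 0) = if none ∈ T then c else 0 := by
  classical
  by_cases hn : none ∈ T
  · rw [if_pos hn, ← Finset.add_sum_erase T _ hn, if_pos rfl, Finset.sum_eq_zero, add_zero]
    intro o ho
    rw [if_neg (Finset.ne_of_mem_erase ho)]
  · rw [if_neg hn]
    refine Finset.sum_eq_zero ?_
    intro o ho
    rw [if_neg]
    rintro rfl
    exact hn ho

/-! ### The cone `v ↦ (0, 1)` in `G × ZMod 3` -/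

/-- The cone of `h`: the apex `none` gets the value `(0, 1)` in `G × ZMod 3`, the index `some i` gets `(h i, 0)`. -/
def soloBlindCone (h : ι → G) : Option ι → G × ZMod 3 :=
  fun o => o.elim (0, 1) (fun i => (h i, 0))

omit [DecidableEq ι] [DecidableEq G] in
/-- Value of the cone at the apex. -/
theorem soloBlindCone_none (h : ι → G) : soloBlindCone h none = (0, 1) := rfl

omit [DecidableEq ι] [DecidableEq G] in
/-- Value of the cone off the apex. -/
theorem soloBlindCone_some (h : ι → G) (i : ι) : soloBlindCone h (some i) = (h i, 0) := rfl

omit [DecidableEq ι] [DecidableEq G] in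
/-- First coordinate of a sub-sum of the cone: the `h`-sum over the non-apex part. -/
theorem soloBlind_cone_sum_fst (h : ι → G) (T : Finset (Option ι)) :
    (∑ o ∈ T, soloBlindCone h o).1 = ∑ i ∈ eraseNone T, h i := by
  rw [Prod.fst_sum, Finset.sum_eraseNone]
  refine Finset.sum_congr rfl ?_
  rintro (_ | i) _ <;> rfl

omit [DecidableEq G] in
/-- Second coordinate of a sub-sum of the cone: `1` if the apex is present, `0` otherwise. -/
theorem soloBlind_cone_sum_snd (h : ι → G) (T : Finset (Option ι)) :
    (∑ o ∈ T, soloBlindCone h o).2 = if none ∈ T then 1 else 0 := by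
  rw [Prod.snd_sum]
  have key : ∀ o : Option ι, (soloBlindCone h o).2 = if o = none then (1 : ZMod 3) else 0 := by
    rintro (_ | i)
    · rw [if_pos rfl]; rfl
    · rw [if_neg (Option.some_ne_none i)]; rfl
  rw [Finset.sum_congr rfl (fun o _ => key o)]
  exact soloBlind_sum_ite_none (G := ZMod 3) T 1

omit [DecidableEq ι] [DecidableEq G] in
/-- `G × ZMod 3` has exponent `3` when `G` has. -/
theorem soloBlind_cone_three (three : ∀ g : G, g + g + g = 0) (g : G × ZMod 3) : g + g + g = 0 := by
  have h3 : ∀ x : ZMod 3, x + x + x = 0 := by decide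
  ext
  · exact three g.1
  · exact h3 g.2

omit [DecidableEq ι] [DecidableEq G] in
/-- The cone of a zero-sum-free `h` is zero-sum free on `insertNone S`. -/
theorem soloBlind_cone_zsf {h : ι → G} {S : Finset ι}
    (zsf : ∀ T ⊆ S, T.Nonempty → ∑ i ∈ T, h i ≠ 0) :
    ∀ T ⊆ insertNone S, T.Nonempty → ∑ o ∈ T, soloBlindCone h o ≠ 0 := by
  classical
  intro T hT hne hsum
  by_cases hn : none ∈ T
  · have h2 : (if none ∈ T then (1 : ZMod 3) else 0) = 0 := by
      have := congrArg Prod.snd hsum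
      rw [soloBlind_cone_sum_snd] at this
      exact this
    rw [if_pos hn] at h2
    exact absurd h2 (by decide)
  · have h1 : ∑ i ∈ eraseNone T, h i = 0 := by
      have := congrArg Prod.fst hsum
      rw [soloBlind_cone_sum_fst] at this
      exact this
    refine zsf (eraseNone T) ?_ ?_ h1
    · intro i hi
      exact some_mem_insertNone.mp (hT (mem_eraseNone.mp hi))
    · obtain ⟨o, ho⟩ := hne
      cases o with
      | none => exact absurd ho hn
      | some i => exact ⟨i, mem_eraseNone.mpr ho⟩

omit [DecidableEq ι] [DecidableEq G] in
/-- In the cone EVERY target `(σ, 1)` is H-good: no sub-sum equals `(σ, 1) + (σ, 1)` (second coordinate). -/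
theorem soloBlind_cone_hgood (h : ι → G) (S : Finset ι) (σ : G) :
    ∀ T ⊆ insertNone S, ∑ o ∈ T, soloBlindCone h o ≠ (σ, 1) + (σ, 1) := by
  classical
  intro T _ hsum
  have h2 : (if none ∈ T then (1 : ZMod 3) else 0) = 1 + 1 := by
    have := congrArg Prod.snd hsum
    rw [soloBlind_cone_sum_snd] at this
    exact this
  by_cases hn : none ∈ T
  · rw [if_pos hn] at h2; exact absurd h2 (by decide)
  · rw [if_neg hn] at h2; exact absurd h2 (by decide)

omit [DecidableEq ι] in
/-- The representations of `(σ, 1)` in the cone are exactly the sets `insertNone T`, `T` a representation of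
`σ`. -/
theorem soloBlind_cone_repAll (h : ι → G) (S : Finset ι) (σ : G) :
    soloBlindSeqRepAll (soloBlindCone h) (insertNone S) ((σ, 1) : G × ZMod 3) =
      (soloBlindSeqRepAll h S σ).map insertNone.toEmbedding := by
  classical
  ext T
  rw [soloBlind_mem_seqRepAll, Finset.mem_map]
  constructor
  · rintro ⟨hT, hsum⟩
    have h2 : (if none ∈ T then (1 : ZMod 3) else 0) = 1 := by
      have := congrArg Prod.snd hsum
      rw [soloBlind_cone_sum_snd] at this
      exact this
    have hn : none ∈ T := by
      by_contra hn
      rw [if_neg hn] at h2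
      exact absurd h2 (by decide)
    refine ⟨eraseNone T, ?_, ?_⟩
    · rw [soloBlind_mem_seqRepAll]
      refine ⟨?_, ?_⟩
      · intro i hi
        exact some_mem_insertNone.mp (hT (mem_eraseNone.mp hi))
      · have := congrArg Prod.fst hsum
        rw [soloBlind_cone_sum_fst] at this
        exact this
    · change insertNone (eraseNone T) = T
      rw [insertNone_eraseNone, Finset.insert_eq_of_mem hn]
  · rintro ⟨U, hU, rfl⟩
    rw [soloBlind_mem_seqRepAll] at hU
    obtain ⟨hUS, hUsum⟩ := hU
    refine ⟨?_, ?_⟩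
    · change insertNone U ⊆ insertNone S
      intro o ho
      rw [mem_insertNone] at ho ⊢
      intro a ha
      exact hUS (ho a ha)
    · change ∑ o ∈ insertNone U, soloBlindCone h o = (σ, 1)
      rw [Finset.sum_insertNone]
      ext
      · rw [Prod.fst_add, Prod.fst_sum]
        change (0 : G) + ∑ i ∈ U, h i = σ
        rw [zero_add, hUsum]
      · rw [Prod.snd_add, Prod.snd_sum]
        change (1 : ZMod 3) + ∑ i ∈ U, (0 : ZMod 3) = 1
        rw [Finset.sum_const_zero, add_zero]

omit [DecidableEq ι] in
/-- THE CONE HALVES THE MASS: `K((σ,1); cone over S) = K(σ; S) / 2`. -/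
theorem soloBlind_cone_mass (h : ι → G) (S : Finset ι) (σ : G) :
    soloBlindMass (soloBlindCone h) (insertNone S) ((σ, 1) : G × ZMod 3) = 1 / 2 * soloBlindMass h S σ := by
  classical
  rw [soloBlindMass, soloBlind_cone_repAll, Finset.sum_map, soloBlindMass, Finset.mul_sum]
  refine Finset.sum_congr rfl fun U _ => ?_
  change (1 / 2 : ℚ) ^ (insertNone U).card = _
  rw [Finset.card_insertNone, pow_succ, mul_comm]

omit [DecidableEq ι] in
/-- CONJECTURE E IMPLIES (K₃) AT EVERY TARGET (cone lift).  If `E(τ'; S') ≤ 1/2` for every exponent-`3` group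
`G'` (universe of `G`), every index type (universe of `ι`), every `h'` zero-sum free on `S'` and every H-good
`τ'`, then `K(σ; S) ≤ 1` for every zero-sum-free `h` on `S` and EVERY target `σ`. -/
theorem soloBlind_kraft_of_conjE
    (hE : ∀ {κ : Type v} {G' : Type u} [AddCommGroup G'] [DecidableEq G'],
      (∀ g : G', g + g + g = 0) → ∀ (h' : κ → G') (S' : Finset κ) (τ' : G'),
      (∀ T ⊆ S', T.Nonempty → ∑ i ∈ T, h' i ≠ 0) → (∀ T ⊆ S', ∑ i ∈ T, h' i ≠ τ' + τ') →
      soloBlindMass h' S' τ' ≤ 1 / 2)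
    (three : ∀ g : G, g + g + g = 0) (h : ι → G) (S : Finset ι)
    (zsf : ∀ T ⊆ S, T.Nonempty → ∑ i ∈ T, h i ≠ 0) (σ : G) : soloBlindMass h S σ ≤ 1 := by
  have hcone := hE (soloBlind_cone_three three) (soloBlindCone h) (insertNone S) (σ, 1)
    (soloBlind_cone_zsf zsf) (soloBlind_cone_hgood h S σ)
  rw [soloBlind_cone_mass] at hcone
  linarith

/-! ### The converse: the virtual point `v ↦ τ` -/

/-- The extension of `h` by an apex of value `τ`. -/
def soloBlindAdjoin (h : ι → G) (τ : G) : Option ι → G :=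
  fun o => o.elim τ h

omit [DecidableEq G] in
/-- Sub-sums of the extension: `τ` if the apex is present, plus the `h`-sum over the non-apex part. -/
theorem soloBlind_adjoin_sum (h : ι → G) (τ : G) (T : Finset (Option ι)) :
    ∑ o ∈ T, soloBlindAdjoin h τ o = (if none ∈ T then τ else 0) + ∑ i ∈ eraseNone T, h i := by
  have key : ∀ o : Option ι, soloBlindAdjoin h τ o = (if o = none then τ else 0) + Option.elim' 0 h o := by
    rintro (_ | i)
    · rw [if_pos rfl]; exact (add_zero τ).symm
    · rw [if_neg (Option.some_ne_none i)]; exact (zero_add (h i)).symm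
  rw [Finset.sum_congr rfl (fun o _ => key o), Finset.sum_add_distrib, soloBlind_sum_ite_none,
    Finset.sum_eraseNone]

omit [DecidableEq ι] in
/-- Masses are invariant under injective re-indexing. -/
theorem soloBlind_mass_map {κ : Type*} (e : ι ↪ κ) (h' : κ → G) (h : ι → G)
    (hh : ∀ i, h' (e i) = h i) (S : Finset ι) (τ : G) :
    soloBlindMass h' (S.map e) τ = soloBlindMass h S τ := by
  classical
  have key : soloBlindSeqRepAll h' (S.map e) τ =
      (soloBlindSeqRepAll h S τ).map (Finset.mapEmbedding e).toEmbedding := by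
    ext T
    rw [soloBlind_mem_seqRepAll, Finset.mem_map]
    constructor
    · rintro ⟨hT, hsum⟩
      obtain ⟨U, hU, rfl⟩ := Finset.subset_map_iff.mp hT
      refine ⟨U, ?_, rfl⟩
      rw [soloBlind_mem_seqRepAll]
      refine ⟨hU, ?_⟩
      rw [Finset.sum_map] at hsum
      simpa only [hh] using hsum
    · rintro ⟨U, hU, rfl⟩
      rw [soloBlind_mem_seqRepAll] at hU
      refine ⟨?_, ?_⟩
      · change U.map e ⊆ S.map e
        exact Finset.map_subset_map.mpr hU.1
      · change ∑ i ∈ U.map e, h' i = τ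
        rw [Finset.sum_map]
        simpa only [hh] using hU.2
  rw [soloBlindMass, key, Finset.sum_map, soloBlindMass]
  refine Finset.sum_congr rfl fun U _ => ?_
  change (1 / 2 : ℚ) ^ (U.map e).card = _
  rw [Finset.card_map]

omit [DecidableEq ι] [DecidableEq G] in
/-- Adjoining an apex of value `τ` to a configuration where `τ` is H-good keeps zero-sum-freeness
(`τ + ∑_T h = 0` would give `∑_T h = -τ = τ + τ`). -/
theorem soloBlind_adjoin_zsf (three : ∀ g : G, g + g + g = 0) {h : ι → G} {S : Finset ι} {τ : G}
    (zsf : ∀ T ⊆ S, T.Nonempty → ∑ i ∈ T, h i ≠ 0) (hgood : ∀ T ⊆ S, ∑ i ∈ T, h i ≠ τ + τ) :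
    ∀ T ⊆ insertNone S, T.Nonempty → ∑ o ∈ T, soloBlindAdjoin h τ o ≠ 0 := by
  classical
  intro T hT hne hsum
  have hsub : eraseNone T ⊆ S := fun i hi => some_mem_insertNone.mp (hT (mem_eraseNone.mp hi))
  rw [soloBlind_adjoin_sum] at hsum
  by_cases hn : none ∈ T
  · rw [if_pos hn] at hsum
    have hsum' : ∑ i ∈ eraseNone T, h i = -τ := eq_neg_of_add_eq_zero_right hsum
    have h2τ : τ + τ = -τ := by
      rw [← sub_eq_zero, sub_neg_eq_add]
      exact three τ
    exact hgood (eraseNone T) hsub (by rw [hsum', h2τ])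
  · rw [if_neg hn, zero_add] at hsum
    refine zsf (eraseNone T) hsub ?_ hsum
    obtain ⟨o, ho⟩ := hne
    cases o with
    | none => exact absurd ho hn
    | some i => exact ⟨i, mem_eraseNone.mpr ho⟩

omit [DecidableEq ι] in
/-- The virtual point identity: `K(τ; S ∪ {v}) = 1/2 + K(τ; S)` for the apex `v ↦ τ` (given zero-sum-freeness of
the extension). -/
theorem soloBlind_adjoin_mass {h : ι → G} {S : Finset ι} {τ : G}
    (zsf' : ∀ T ⊆ insertNone S, T.Nonempty → ∑ o ∈ T, soloBlindAdjoin h τ o ≠ 0) :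
    soloBlindMass (soloBlindAdjoin h τ) (insertNone S) τ = 1 / 2 + soloBlindMass h S τ := by
  classical
  have hv : (none : Option ι) ∈ insertNone S := none_mem_insertNone
  have h1 := soloBlind_mass_value_split zsf' hv
  change soloBlindMass (soloBlindAdjoin h τ) (insertNone S) τ =
    1 / 2 + soloBlindMass (soloBlindAdjoin h τ) ((insertNone S).erase none) τ at h1
  rw [h1]
  congr 1
  have herase : (insertNone S).erase none = S.map Function.Embedding.some := by
    ext o
    cases o with
    | none => simp
    | some i => simp
  rw [herase]
  exact soloBlind_mass_map Function.Embedding.some _ h (fun _ => rfl) S τ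

omit [DecidableEq ι] in
/-- (K₃) IMPLIES CONJECTURE E (the virtual point `v ↦ τ`).  If `K(σ'; S') ≤ 1` for every exponent-`3` group
(universe of `G`), every index type (universe of `ι`), every zero-sum-free `h'` and every target, then
`E(τ; S) ≤ 1/2` for every H-good `τ`.  With `soloBlind_kraft_of_conjE`: E and (K₃) are equivalent. -/
theorem soloBlind_conjE_of_kraft
    (hK : ∀ {κ : Type v} {G' : Type u} [AddCommGroup G'] [DecidableEq G'],
      (∀ g : G', g + g + g = 0) → ∀ (h' : κ → G') (S' : Finset κ) (σ' : G'),
      (∀ T ⊆ S', T.Nonempty → ∑ i ∈ T, h' i ≠ 0) → soloBlindMass h' S' σ' ≤ 1)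
    (three : ∀ g : G, g + g + g = 0) (h : ι → G) (S : Finset ι)
    (zsf : ∀ T ⊆ S, T.Nonempty → ∑ i ∈ T, h i ≠ 0) (τ : G)
    (hgood : ∀ T ⊆ S, ∑ i ∈ T, h i ≠ τ + τ) : soloBlindMass h S τ ≤ 1 / 2 := by
  have zsf' := soloBlind_adjoin_zsf three zsf hgood
  have hv := hK three (soloBlindAdjoin h τ) (insertNone S) τ zsf'
  rw [soloBlind_adjoin_mass zsf'] at hv
  linarith

end Summit.MatrixMultiplication.MatrixMultiplication.Theorems
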